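import Literature.NumberTheory.LFunctions.ZetaZeroFreeStripLowerBound
import Literature.NumberTheory.LFunctions.LevinsonClosureProofs
import Literature.Analysis.Complex.VerticalLineShift
import Literature.Analysis.SpecialFunctions.GammaStirlingOrder
import Mathlib.Analysis.SpecialFunctions.Gaussian.FourierTransform
import HarnessLib

/-!
# RH-FREE (conditional on a zero-free strip, as a hypothesis) · Levinson's Gaussian Mellin kernel `R(u)` (Levinson 1956, §4 Lemma, (3.5)–(3.6)) — nothing here bears on the truth of RH

Literature-typing tranche `rh-lit-broughan-2` (Broughan, *Equivalents of the Riemann Hypothesis*,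
Vol. 2, Ch. 8 §8.5 "Levinson's Equivalence"). Step 2/3 of the discharge of the named fact
`Literature.NumberTheory.LFunctions.Levinson1956_criterion` (direction "zero-free strip ⟹
closure"): the LEMMA of [Levinson1956, §3 p. 841 / §4]. Throughout, `ζ(s) ≠ 0` on an open strip
`a − δ < Re s < b + δ` with `1/2 ≤ a ≤ b < 1` is a HYPOTHESIS (`hZ`), never asserted.

«LEMMA. For any fixed real `p` there exists a function `R(u)` continuous for `u > 0` and such that
(3.5) `∫₀^∞ u^{−k} |R(u)| du < ∞` for all `k`, `σ₁ < k < σ₂`, and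
(3.6) `∫₀^∞ e^{−ux}/(1 + e^{−ux}) R(u) du = exp(−½ log² x + i p log x)`.»
Levinson's `R` is (4.0) `R(u) = (i(2π)^{1/2})^{−1} ∫_{c−i∞}^{c+i∞} exp((s+ip)²/2) u^{s−1} ds /
(Γ(s) ζ(s) (1 − 2^{1−s}))`, `σ₁ < c < σ₂`. We use the same function up to the factor `(2π)^{1/2}`:
with `Φ_p(s) = exp((s+ip)²/2) / (Γ(s)(1 − 2^{1−s})ζ(s))` (the tree's Fermi–Dirac Mellin
denominator `Γ(s)((1 − 2^{1−s})ζ(s))`, file `SalemIntegralEquationProofs`),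

  `R_c(u) = ∫_ℝ Φ_p(c + it) u^{c + it − 1} dt`  (`= (2π)^{1/2} R(u)` of Levinson),

and prove, exactly along [Levinson1956, §4]:

* `norm_one_sub_two_cpow_ge` — `|1 − 2^{1−s}| ≥ (1 − σ) log 2` (`σ = Re s ≤ 1`);
* `exists_norm_phi_le` — (4.1)–(4.2): `|Φ_p(σ + it)| ≤ K e^{−t²/8}` uniformly for `a ≤ σ ≤ b`
  (`|ζ|^{-1} ≤ C(|t|+2)^C` from `ZetaZeroFreeStripLowerBound`, `|Γ| ≥ (2/15)e^{−π|t|/2}` from the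
  tree's `norm_Gamma_ge_exp`, and the Gaussian factor);
* `differentiableOn_phi_mul_cpow`, `differentiableOn_phi` — `s ↦ Φ_p(s) u^{s−1}` and `Φ_p` are holomorphic on the closed strip;
* `integrable_phi_mul_cpow_line` — absolute convergence on vertical lines;
* `kernel_eq_of_mem_Icc` — (4.3)ff.: `R_c(u) = R_{c'}(u)` for `c, c' ∈ [a,b]` («follows at once from
  the Cauchy integral theorem»; the tree's `integral_vertical_eq_of_differentiableOn`);
* `norm_kernel_le` — (4.3): `|R_c(u)| ≤ B u^{c−1}`;
* `stronglyMeasurable_kernel` — measurability of `R_c`;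
* `integrableOn_rpow_neg_mul_norm_kernel` — (3.5): `∫₀^∞ u^{−k}|R(u)| du < ∞` for `a < k < b`
  (split at `u = 1`, `c = b` on `(0,1)`, `c = a` on `(1,∞)`);
* `integral_fermiDirac_mul_kernel` — (3.6): for `x > 0`,
  `∫₀^∞ R_c(u) du/(e^{ux} + 1) = (2π)^{1/2} exp(i p log x − ½ log² x)`
  (Fubini; the Fermi–Dirac Mellin transform `∫₀^∞ u^{s−1} du/(e^{xu}+1) = x^{−s}Γ(s)(1−2^{1−s})ζ(s)`
  of the tree, `integral_cpow_mul_fermiDirac_comp`; then Mathlib's Gaussian integral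
  `integral_cexp_quadratic`).

No definitions (the kernel is carried as a function `R` with its defining hypothesis), no named
facts (D-0026); standard axioms only. Continuity of `R` (stated by Levinson) is not needed
downstream and is replaced by measurability.

## References

* [Levinson1956] N. Levinson, *On closure problems and the zeros of the Riemann zeta function*,
  Proc. Amer. Math. Soc. 7 (1956) 838–845, §3 Lemma (3.5)–(3.6), §4 (4.0)–(4.3).
* [Titchmarsh1986] E. C. Titchmarsh, *The Theory of the Riemann Zeta-Function*, Thm 9.6 (B), (2.2.1)/§2.5.
* [Broughan2017] K. Broughan, *Equivalents of the Riemann Hypothesis*, Vol. 2, §8.5 (secondary).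
-/

noncomputable section

open Complex Filter Set MeasureTheory
open scoped Topology Real

namespace Literature.NumberTheory.LFunctions

namespace LevinsonKernel

/-! ## Elementary bounds on the factors of `Φ` -/

/-- `|1 − 2^{1−s}| ≥ (1 − Re s) log 2` (since `|2^{1−s}| = 2^{1−σ} ≥ 1 + (1−σ) log 2`; useful for `Re s < 1`).
[folklore] -/
private theorem norm_one_sub_two_cpow_ge (s : ℂ) :
    (1 - s.re) * Real.log 2 ≤ ‖1 - (2 : ℂ) ^ (1 - s)‖ := by
  have h2 : ‖(2 : ℂ) ^ (1 - s)‖ = (2 : ℝ) ^ (1 - s.re) := by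
    have := Complex.norm_cpow_eq_rpow_re_of_pos (by norm_num : (0 : ℝ) < 2) (1 - s)
    simp only [ofReal_ofNat, sub_re, one_re] at this
    exact this
  have h3 : 1 + (1 - s.re) * Real.log 2 ≤ (2 : ℝ) ^ (1 - s.re) := by
    rw [Real.rpow_def_of_pos (by norm_num : (0 : ℝ) < 2)]
    linarith [Real.add_one_le_exp (Real.log 2 * (1 - s.re))]
  have h4 : ‖(2 : ℂ) ^ (1 - s)‖ - ‖(1 : ℂ)‖ ≤ ‖1 - (2 : ℂ) ^ (1 - s)‖ := by
    rw [norm_sub_rev]; exact norm_sub_norm_le _ _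
  rw [norm_one, h2] at h4
  linarith

/-- The Gaussian factor: `|exp((s + ip)²/2)| = exp((σ² − (t+p)²)/2)` for `s = σ + it`. [folklore] -/
private theorem norm_cexp_sq_half (σ t p : ℝ) :
    ‖cexp (((σ : ℂ) + t * I + p * I) ^ 2 / 2)‖ = Real.exp ((σ ^ 2 - (t + p) ^ 2) / 2) := by
  rw [Complex.norm_exp]
  congr 1
  have : ((σ : ℂ) + t * I + p * I) ^ 2 / 2 = (((σ ^ 2 - (t + p) ^ 2) / 2 : ℝ) : ℂ) +
      ((σ * (t + p) : ℝ) : ℂ) * I := by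
    push_cast
    ring_nf
    rw [Complex.I_sq]
    ring
  rw [this, Complex.add_re, Complex.ofReal_re, Complex.re_ofReal_mul, Complex.I_re, mul_zero,
    add_zero]

/-- `−(t+p)²/2 + M|t| ≤ −t²/8 + p² + 2M² + ...`: the elementary absorption
`−(t+p)²/2 + M |t| ≤ −t²/8 + p²/2 + 2 M²` (`M ≥ 0`). [folklore] -/
private theorem gauss_absorb (t p M : ℝ) :
    -(t + p) ^ 2 / 2 + M * |t| ≤ -t ^ 2 / 8 + p ^ 2 / 2 + 2 * M ^ 2 := by
  have h1 : -(t + p) ^ 2 / 2 ≤ -t ^ 2 / 4 + p ^ 2 / 2 := by nlinarith [sq_nonneg (t + 2 * p)]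
  have h2 : M * |t| - t ^ 2 / 8 ≤ 2 * M ^ 2 := by
    rcases le_or_gt 0 t with ht | ht
    · rw [abs_of_nonneg ht]; nlinarith [sq_nonneg (t - 4 * M)]
    · rw [abs_of_neg ht]; nlinarith [sq_nonneg (t + 4 * M)]
  nlinarith

/-! ## The integrand `Φ_p` on the strip -/

variable {a b δ : ℝ}

/-- **(4.1)–(4.2): Gaussian decay of `Φ_p` on vertical lines of the strip**, uniformly in
`a ≤ σ ≤ b`: if `ζ ≠ 0` for `a − δ < Re s < b + δ` (`1/2 ≤ a ≤ b < 1`, `δ > 0`), then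
`|exp((s+ip)²/2) / (Γ(s)(1−2^{1−s})ζ(s))| ≤ K e^{−t²/8}` for `s = σ + it`, `a ≤ σ ≤ b`.
[cite: Levinson1956, §4 (4.1)–(4.2)] -/
theorem exists_norm_phi_le (hδ : 0 < δ) (ha : 1 / 2 ≤ a) (hab : a ≤ b) (hb : b < 1)
    (hZ : ∀ s : ℂ, a - δ < s.re → s.re < b + δ → riemannZeta s ≠ 0) (p : ℝ) :
    ∃ K : ℝ, 0 < K ∧ ∀ σ ∈ Icc a b, ∀ t : ℝ,
      ‖cexp ((((σ : ℂ) + t * I) + p * I) ^ 2 / 2) /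
          (Complex.Gamma ((σ : ℂ) + t * I) * ((1 - 2 ^ (1 - ((σ : ℂ) + t * I))) *
            riemannZeta ((σ : ℂ) + t * I)))‖ ≤ K * Real.exp (-t ^ 2 / 8) := by
  obtain ⟨C, hC, hζ⟩ := ZetaStripLowerBound.exists_norm_inv_riemannZeta_le_of_zeroFree_strip hδ
    (by linarith) hab hb hZ
  have hlog2 : 0 < Real.log 2 := Real.log_pos (by norm_num)
  have h1b : 0 < 1 - b := by linarith
  set M : ℝ := π / 2 + C with hM
  have hM0 : 0 ≤ M := by positivity
  refine ⟨15 / 2 * C / ((1 - b) * Real.log 2) * Real.exp (1 / 2 + p ^ 2 / 2 + 2 * M ^ 2 + 2 * C),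
    by positivity, fun σ hσ t ↦ ?_⟩
  set s : ℂ := (σ : ℂ) + t * I with hs
  have hsre : s.re = σ := by simp [hs]
  have hσ0 : 1 / 2 ≤ σ := ha.trans hσ.1
  have hσ1 : σ < 1 := lt_of_le_of_lt hσ.2 hb
  -- the three denominators
  have hΓ : 2 / 15 * Real.exp (-(π * |t|) / 2) ≤ ‖Complex.Gamma s‖ :=
    Literature.Analysis.SpecialFunctions.norm_Gamma_ge_exp hσ0 (by linarith) t
  have hΓ0 : 0 < ‖Complex.Gamma s‖ := lt_of_lt_of_le (by positivity) hΓ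
  have h2 : (1 - b) * Real.log 2 ≤ ‖1 - (2 : ℂ) ^ (1 - s)‖ := by
    have := norm_one_sub_two_cpow_ge s
    rw [hsre] at this
    exact le_trans (mul_le_mul_of_nonneg_right (by linarith [hσ.2]) hlog2.le) this
  have h20 : 0 < ‖1 - (2 : ℂ) ^ (1 - s)‖ := lt_of_lt_of_le (by positivity) h2
  have hζs := hζ σ hσ t
  have hζne : riemannZeta s ≠ 0 := hZ s (by rw [hsre]; linarith [hσ.1]) (by rw [hsre]; linarith [hσ.2])
  have hζ0 : 0 < ‖riemannZeta s‖ := norm_pos_iff.2 hζne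
  rw [norm_inv] at hζs
  -- the numerator
  have hnum : ‖cexp ((s + p * I) ^ 2 / 2)‖ = Real.exp ((σ ^ 2 - (t + p) ^ 2) / 2) := by
    rw [hs]; exact norm_cexp_sq_half σ t p
  -- combine
  rw [norm_div, norm_mul, norm_mul, hnum]
  have hden : 2 / 15 * Real.exp (-(π * |t|) / 2) * ((1 - b) * Real.log 2) * (C * (|t| + 2) ^ C)⁻¹
      ≤ ‖Complex.Gamma s‖ * (‖1 - (2 : ℂ) ^ (1 - s)‖ * ‖riemannZeta s‖) := by
    have hz' : (C * (|t| + 2) ^ C)⁻¹ ≤ ‖riemannZeta s‖ := by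
      rw [inv_le_comm₀ (by positivity) hζ0]; exact hζs
    have := mul_le_mul h2 hz' (by positivity) (norm_nonneg _)
    calc 2 / 15 * Real.exp (-(π * |t|) / 2) * ((1 - b) * Real.log 2) * (C * (|t| + 2) ^ C)⁻¹
        = (2 / 15 * Real.exp (-(π * |t|) / 2)) * (((1 - b) * Real.log 2) * (C * (|t| + 2) ^ C)⁻¹) := by
          ring
      _ ≤ ‖Complex.Gamma s‖ * (‖1 - (2 : ℂ) ^ (1 - s)‖ * ‖riemannZeta s‖) :=
          mul_le_mul hΓ this (by positivity) (norm_nonneg _)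
  have hden0 : 0 < 2 / 15 * Real.exp (-(π * |t|) / 2) * ((1 - b) * Real.log 2) *
      (C * (|t| + 2) ^ C)⁻¹ := by positivity
  calc Real.exp ((σ ^ 2 - (t + p) ^ 2) / 2) / (‖Complex.Gamma s‖ * (‖1 - (2 : ℂ) ^ (1 - s)‖ * ‖riemannZeta s‖))
      ≤ Real.exp ((σ ^ 2 - (t + p) ^ 2) / 2) /
          (2 / 15 * Real.exp (-(π * |t|) / 2) * ((1 - b) * Real.log 2) * (C * (|t| + 2) ^ C)⁻¹) :=
        div_le_div_of_nonneg_left (Real.exp_pos _).le hden0 hden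
    _ = 15 / 2 * C / ((1 - b) * Real.log 2) *
          (Real.exp ((σ ^ 2 - (t + p) ^ 2) / 2) * Real.exp (π * |t| / 2) * (|t| + 2) ^ C) := by
        have e1 : Real.exp (-(π * |t|) / 2) = (Real.exp (π * |t| / 2))⁻¹ := by
          rw [← Real.exp_neg]; ring_nf
        rw [e1]
        field_simp
    _ ≤ 15 / 2 * C / ((1 - b) * Real.log 2) *
          (Real.exp (1 / 2 + p ^ 2 / 2 + 2 * M ^ 2 + 2 * C) * Real.exp (-t ^ 2 / 8)) := by
        refine mul_le_mul_of_nonneg_left ?_ (by positivity)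
        -- `(|t|+2)^C ≤ exp(C(|t|+2))`
        have hpow : (|t| + 2) ^ C ≤ Real.exp (C * (|t| + 2)) := by
          rw [Real.rpow_def_of_pos (by positivity), Real.exp_le_exp]
          have := Real.log_le_sub_one_of_pos (show (0:ℝ) < |t| + 2 by positivity)
          nlinarith [hC.le]
        have hσ2 : σ ^ 2 ≤ 1 := by nlinarith
        calc Real.exp ((σ ^ 2 - (t + p) ^ 2) / 2) * Real.exp (π * |t| / 2) * (|t| + 2) ^ C
            ≤ Real.exp ((σ ^ 2 - (t + p) ^ 2) / 2) * Real.exp (π * |t| / 2) *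
                Real.exp (C * (|t| + 2)) := by gcongr
          _ = Real.exp ((σ ^ 2 - (t + p) ^ 2) / 2 + π * |t| / 2 + C * (|t| + 2)) := by
                rw [← Real.exp_add, ← Real.exp_add]
          _ ≤ Real.exp (1 / 2 + p ^ 2 / 2 + 2 * M ^ 2 + 2 * C + -t ^ 2 / 8) := by
                rw [Real.exp_le_exp]
                have hg := gauss_absorb t p M
                rw [hM] at hg ⊢
                nlinarith [hσ2, abs_nonneg t]
          _ = Real.exp (1 / 2 + p ^ 2 / 2 + 2 * M ^ 2 + 2 * C) * Real.exp (-t ^ 2 / 8) := by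
                rw [← Real.exp_add]
    _ = 15 / 2 * C / ((1 - b) * Real.log 2) * Real.exp (1 / 2 + p ^ 2 / 2 + 2 * M ^ 2 + 2 * C) *
          Real.exp (-t ^ 2 / 8) := by ring

/-- **Holomorphy of `s ↦ Φ_p(s) u^{s−1}` on the closed strip `a ≤ Re s ≤ b`** (inside the zero-free
open strip; `Γ` is holomorphic and zero-free on `Re s > 0`, `1 − 2^{1−s} ≠ 0` and `ζ` holomorphic
for `Re s < 1`). [cite: Levinson1956, §4 (proof of (4.3), "Cauchy integral theorem")] -/
theorem differentiableOn_phi_mul_cpow (hδ : 0 < δ) (ha : 1 / 2 ≤ a) (hb : b < 1)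
    (hZ : ∀ s : ℂ, a - δ < s.re → s.re < b + δ → riemannZeta s ≠ 0) (p : ℝ) {u : ℝ} (hu : 0 < u) :
    DifferentiableOn ℂ (fun s : ℂ ↦ cexp ((s + p * I) ^ 2 / 2) /
        (Complex.Gamma s * ((1 - 2 ^ (1 - s)) * riemannZeta s)) * (u : ℂ) ^ (s - 1)) (re ⁻¹' Icc a b) := by
  intro s hs
  have hs' : a ≤ s.re ∧ s.re ≤ b := hs
  have hre0 : 0 < s.re := by linarith
  have hs1 : s ≠ 1 := by
    intro h; rw [h, one_re] at hs'; linarith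
  have hΓ : DifferentiableAt ℂ Complex.Gamma s := by
    refine Complex.differentiableAt_Gamma s fun m h ↦ ?_
    rw [h] at hre0
    simp at hre0
    linarith [m.cast_nonneg (α := ℝ)]
  have hΓ0 : Complex.Gamma s ≠ 0 := Complex.Gamma_ne_zero_of_re_pos hre0
  have hζd : DifferentiableAt ℂ riemannZeta s := differentiableAt_riemannZeta hs1
  have hζ0 : riemannZeta s ≠ 0 := hZ s (by linarith) (by linarith)
  have h2d : DifferentiableAt ℂ (fun s : ℂ ↦ (1 : ℂ) - 2 ^ (1 - s)) s := by
    refine (differentiableAt_const _).sub ?_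
    exact ((differentiableAt_const _).sub differentiableAt_id).const_cpow (Or.inl two_ne_zero)
  have h20 : (1 : ℂ) - 2 ^ (1 - s) ≠ 0 := by
    intro h
    have := norm_one_sub_two_cpow_ge s
    rw [h, norm_zero] at this
    have hlog2 : 0 < Real.log 2 := Real.log_pos (by norm_num)
    nlinarith
  have hnum : DifferentiableAt ℂ (fun s : ℂ ↦ cexp ((s + p * I) ^ 2 / 2)) s := by fun_prop
  have hden : DifferentiableAt ℂ (fun s : ℂ ↦ Complex.Gamma s * ((1 - 2 ^ (1 - s)) * riemannZeta s)) s :=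
    hΓ.mul (h2d.mul hζd)
  have hcpow : DifferentiableAt ℂ (fun s : ℂ ↦ (u : ℂ) ^ (s - 1)) s :=
    (differentiableAt_id.sub (differentiableAt_const _)).const_cpow
      (Or.inl (by exact_mod_cast hu.ne'))
  exact ((hnum.div hden (mul_ne_zero hΓ0 (mul_ne_zero h20 hζ0))).mul hcpow).differentiableWithinAt

/-- **Holomorphy of `Φ_p` on the closed strip `a ≤ Re s ≤ b`** (the integrand of (4.0) «is regular»
between the lines, which is what makes `R` independent of `c`). [cite: Levinson1956, §4 (4.0)–(4.3)] -/
theorem differentiableOn_phi (hδ : 0 < δ) (ha : 1 / 2 ≤ a) (hb : b < 1)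
    (hZ : ∀ s : ℂ, a - δ < s.re → s.re < b + δ → riemannZeta s ≠ 0) (p : ℝ) :
    DifferentiableOn ℂ (fun s : ℂ ↦ cexp ((s + p * I) ^ 2 / 2) /
        (Complex.Gamma s * ((1 - 2 ^ (1 - s)) * riemannZeta s))) (re ⁻¹' Icc a b) := by
  have h := differentiableOn_phi_mul_cpow hδ ha hb hZ p zero_lt_one
  refine h.congr fun s _ ↦ ?_
  simp


/-! ## The kernel `R_c(u) = ∫ Φ(c + it) u^{c + it − 1} dt` of a holomorphic `Φ` with Gaussian decay

In this section `Φ` is any function holomorphic on the closed strip `a ≤ Re s ≤ b` with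
`|Φ(σ + it)| ≤ K e^{−t²/8}` there (for Levinson's `Φ_p` these are `exists_norm_phi_le` and
`differentiableOn_phi`). -/

section Kernel

variable {a b K : ℝ} {Φ : ℂ → ℂ}

/-- `t ↦ Φ(σ + it)` is continuous for `a ≤ σ ≤ b`. [folklore] -/
private theorem continuous_phi_line (hΦd : DifferentiableOn ℂ Φ (re ⁻¹' Icc a b)) {σ : ℝ}
    (hσ : σ ∈ Icc a b) : Continuous fun t : ℝ ↦ Φ ((σ : ℂ) + t * I) := by
  have hc : ContinuousOn Φ (re ⁻¹' Icc a b) := hΦd.continuousOn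
  refine hc.comp_continuous (by fun_prop) fun t ↦ ?_
  simpa using hσ

/-- `‖u^{σ + it − 1}‖ = u^{σ − 1}` for `u > 0`. [folklore] -/
private theorem norm_cpow_line {u : ℝ} (hu : 0 < u) (σ t : ℝ) :
    ‖(u : ℂ) ^ ((σ : ℂ) + t * I - 1)‖ = u ^ (σ - 1) := by
  rw [Complex.norm_cpow_eq_rpow_re_of_pos hu]
  simp

/-- The integrand `(u,t) ↦ Φ(c + it) u^{c + it − 1}` is jointly measurable. [folklore] -/
private theorem measurable_phi_mul_cpow (hΦd : DifferentiableOn ℂ Φ (re ⁻¹' Icc a b)) {c : ℝ}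
    (hc : c ∈ Icc a b) :
    Measurable fun q : ℝ × ℝ ↦ Φ ((c : ℂ) + q.2 * I) * (q.1 : ℂ) ^ ((c : ℂ) + q.2 * I - 1) := by
  have h1 : Measurable fun q : ℝ × ℝ ↦ Φ ((c : ℂ) + q.2 * I) :=
    (continuous_phi_line hΦd hc).measurable.comp measurable_snd
  have h2 : Measurable fun q : ℝ × ℝ ↦ (q.1 : ℂ) ^ ((c : ℂ) + q.2 * I - 1) := by
    refine Measurable.pow ?_ ?_
    · exact Complex.measurable_ofReal.comp measurable_fst
    · exact ((Complex.measurable_ofReal.comp measurable_snd).mul_const I |>.const_add _).sub_const _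
  exact h1.mul h2

/-- **Absolute convergence on vertical lines**: `t ↦ Φ(σ + it) u^{σ + it − 1}` is integrable for
`a ≤ σ ≤ b`, `u > 0`, with `∫ |·| ≤ K (∫ e^{−t²/8}) u^{σ−1}`. [cite: Levinson1956, §4 (4.2)–(4.3)] -/
theorem integrable_phi_mul_cpow_line (hΦd : DifferentiableOn ℂ Φ (re ⁻¹' Icc a b))
    (hK : ∀ σ ∈ Icc a b, ∀ t : ℝ, ‖Φ ((σ : ℂ) + t * I)‖ ≤ K * Real.exp (-t ^ 2 / 8))
    {σ : ℝ} (hσ : σ ∈ Icc a b) {u : ℝ} (hu : 0 < u) :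
    Integrable fun t : ℝ ↦ Φ ((σ : ℂ) + t * I) * (u : ℂ) ^ ((σ : ℂ) + t * I - 1) := by
  have hgauss : Integrable fun t : ℝ ↦ K * Real.exp (-t ^ 2 / 8) * u ^ (σ - 1) := by
    have h := (integrable_exp_neg_mul_sq (by norm_num : (0 : ℝ) < 1 / 8)).const_mul K
    refine (h.mul_const (u ^ (σ - 1))).congr (ae_of_all _ fun t ↦ ?_)
    simp only; ring_nf
  refine hgauss.mono' ?_ (ae_of_all _ fun t ↦ ?_)
  · exact ((continuous_phi_line hΦd hσ).mul (by
      refine continuous_const.cpow (by fun_prop) fun t ↦ Or.inl ?_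
      · exact_mod_cast hu)).aestronglyMeasurable
  · rw [norm_mul, norm_cpow_line hu]
    exact mul_le_mul_of_nonneg_right (hK σ hσ t) (Real.rpow_nonneg hu.le _)

/-- **Decay on horizontal segments**: `Φ(x + iT) u^{x + iT − 1} → 0` uniformly for `a ≤ x ≤ b` as
`|T| → ∞`. [folklore] -/
private theorem decay_phi_mul_cpow (hK : ∀ σ ∈ Icc a b, ∀ t : ℝ, ‖Φ ((σ : ℂ) + t * I)‖ ≤ K * Real.exp (-t ^ 2 / 8))
    (hK0 : 0 < K) {u : ℝ} (hu : 0 < u) :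
    ∀ ε : ℝ, 0 < ε → ∃ T₀ : ℝ, ∀ T : ℝ, T₀ ≤ |T| → ∀ x ∈ Icc a b,
      ‖Φ ((x : ℂ) + T * I) * (u : ℂ) ^ ((x : ℂ) + T * I - 1)‖ ≤ ε := by
  intro ε hε
  -- `u^{x-1} ≤ M := u^{a-1} + u^{b-1}` on `[a,b]`
  set M : ℝ := u ^ (a - 1) + u ^ (b - 1) with hM
  have hM0 : 0 < M := by positivity
  have hpow : ∀ x ∈ Icc a b, u ^ (x - 1) ≤ M := by
    intro x hx
    rcases le_or_gt 1 u with h1 | h1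
    · have : u ^ (x - 1) ≤ u ^ (b - 1) := Real.rpow_le_rpow_of_exponent_le h1 (by linarith [hx.2])
      linarith [Real.rpow_nonneg hu.le (a - 1)]
    · have : u ^ (x - 1) ≤ u ^ (a - 1) :=
        Real.rpow_le_rpow_of_exponent_ge hu h1.le (by linarith [hx.1])
      linarith [Real.rpow_nonneg hu.le (b - 1)]
  -- choose `T₀` with `K M e^{-T₀²/8} ≤ ε`: `e^{-T²/8} ≤ 8/T²`
  obtain ⟨T₀, hT₀1, hT₀⟩ : ∃ T₀ : ℝ, 1 ≤ T₀ ∧ K * M * (8 / T₀ ^ 2) ≤ ε := by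
    refine ⟨max 1 (Real.sqrt (8 * K * M / ε)), le_max_left _ _, ?_⟩
    have hs : Real.sqrt (8 * K * M / ε) ≤ max 1 (Real.sqrt (8 * K * M / ε)) := le_max_right _ _
    have hs2 : 8 * K * M / ε ≤ (max 1 (Real.sqrt (8 * K * M / ε))) ^ 2 := by
      calc 8 * K * M / ε = (Real.sqrt (8 * K * M / ε)) ^ 2 := by
            rw [Real.sq_sqrt (by positivity)]
        _ ≤ _ := by gcongr
    have hpos : 0 < (max 1 (Real.sqrt (8 * K * M / ε))) ^ 2 := by positivity
    rw [div_le_iff₀ hε] at hs2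
    rw [mul_div_assoc', div_le_iff₀ hpos]
    linarith
  refine ⟨T₀, fun T hT x hx ↦ ?_⟩
  have hT1 : 1 ≤ |T| := hT₀1.trans hT
  have hT2 : 0 < T ^ 2 := by rw [← sq_abs]; positivity
  rw [norm_mul, norm_cpow_line hu]
  have hexp : Real.exp (-T ^ 2 / 8) ≤ 8 / T ^ 2 := by
    -- `e^{y} ≥ 1 + y` with `y = T²/8`
    have h1 : 1 + T ^ 2 / 8 ≤ Real.exp (T ^ 2 / 8) := by linarith [Real.add_one_le_exp (T ^ 2 / 8)]
    rw [show -T ^ 2 / 8 = -(T ^ 2 / 8) by ring, Real.exp_neg, inv_le_comm₀ (Real.exp_pos _) (by positivity)]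
    calc (8 / T ^ 2)⁻¹ = T ^ 2 / 8 := by rw [inv_div]
      _ ≤ Real.exp (T ^ 2 / 8) := by linarith
  have h8 : 8 / T ^ 2 ≤ 8 / T₀ ^ 2 := by
    have : T₀ ^ 2 ≤ T ^ 2 := by rw [← sq_abs T]; gcongr
    exact div_le_div_of_nonneg_left (by norm_num) (by positivity) this
  calc ‖Φ ((x : ℂ) + T * I)‖ * u ^ (x - 1) ≤ K * Real.exp (-T ^ 2 / 8) * M :=
        mul_le_mul (hK x hx T) (hpow x hx) (Real.rpow_nonneg hu.le _) (by positivity)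
    _ ≤ K * (8 / T₀ ^ 2) * M := by gcongr; exact hexp.trans h8
    _ = K * M * (8 / T₀ ^ 2) := by ring
    _ ≤ ε := hT₀

/-- **The kernel does not depend on the abscissa** ([Levinson1956, §4]: «That `R(u)` does not depend
on `c` … follows at once from the Cauchy integral theorem»): for `c, c' ∈ [a,b]` and `u > 0`,
`∫ Φ(c+it) u^{c+it−1} dt = ∫ Φ(c'+it) u^{c'+it−1} dt`. [cite: Levinson1956, §4 (independence of c)] -/
theorem kernel_eq_of_mem_Icc (hΦd : DifferentiableOn ℂ Φ (re ⁻¹' Icc a b))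
    (hK : ∀ σ ∈ Icc a b, ∀ t : ℝ, ‖Φ ((σ : ℂ) + t * I)‖ ≤ K * Real.exp (-t ^ 2 / 8)) (hK0 : 0 < K)
    {c c' : ℝ} (hc : c ∈ Icc a b) (hc' : c' ∈ Icc a b) {u : ℝ} (hu : 0 < u) :
    ∫ t : ℝ, Φ ((c : ℂ) + t * I) * (u : ℂ) ^ ((c : ℂ) + t * I - 1) =
      ∫ t : ℝ, Φ ((c' : ℂ) + t * I) * (u : ℂ) ^ ((c' : ℂ) + t * I - 1) := by
  -- the holomorphic function `F(s) = Φ(s) u^{s-1}`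
  set F : ℂ → ℂ := fun s ↦ Φ s * (u : ℂ) ^ (s - 1) with hF
  have hFline : ∀ x : ℝ, ∀ y : ℝ, F ((x : ℂ) + y * I) =
      Φ ((x : ℂ) + y * I) * (u : ℂ) ^ ((x : ℂ) + y * I - 1) := fun x y ↦ rfl
  have key : ∀ {c c' : ℝ}, c ≤ c' → c ∈ Icc a b → c' ∈ Icc a b →
      ∫ y : ℝ, F ((c : ℂ) + y * I) = ∫ y : ℝ, F ((c' : ℂ) + y * I) := by
    intro c c' hcc' hc hc'
    have hsub : re ⁻¹' Icc c c' ⊆ re ⁻¹' Icc a b := fun s hs ↦ ⟨hc.1.trans hs.1, hs.2.trans hc'.2⟩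
    have hFd : DifferentiableOn ℂ F (re ⁻¹' Icc c c') := by
      intro s hs
      have hΦs := (hΦd s (hsub hs))
      have hcpow : DifferentiableAt ℂ (fun s : ℂ ↦ (u : ℂ) ^ (s - 1)) s :=
        (differentiableAt_id.sub (differentiableAt_const _)).const_cpow
          (Or.inl (by exact_mod_cast hu.ne'))
      exact (hΦs.mul (hcpow.differentiableWithinAt (s := re ⁻¹' Icc a b))).mono hsub
    refine Literature.Analysis.Complex.integral_vertical_eq_of_differentiableOn hcc' hFd
      (integrable_phi_mul_cpow_line hΦd hK hc hu) (integrable_phi_mul_cpow_line hΦd hK hc' hu) ?_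
    intro ε hε
    obtain ⟨T₀, hT₀⟩ := decay_phi_mul_cpow hK hK0 hu ε hε
    exact ⟨T₀, fun T hT x hx ↦ hT₀ T hT x ⟨hc.1.trans hx.1, hx.2.trans hc'.2⟩⟩
  rcases le_total c c' with h | h
  · exact key h hc hc'
  · exact (key h hc' hc).symm

/-- **(4.3): `|R_c(u)| ≤ B u^{c−1}`** with `B = K ∫ e^{−t²/8} dt`. [cite: Levinson1956, §4 (4.3)] -/
theorem norm_kernel_le
    (hK : ∀ σ ∈ Icc a b, ∀ t : ℝ, ‖Φ ((σ : ℂ) + t * I)‖ ≤ K * Real.exp (-t ^ 2 / 8))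
    {c : ℝ} (hc : c ∈ Icc a b) {u : ℝ} (hu : 0 < u) :
    ‖∫ t : ℝ, Φ ((c : ℂ) + t * I) * (u : ℂ) ^ ((c : ℂ) + t * I - 1)‖ ≤
      (K * ∫ t : ℝ, Real.exp (-t ^ 2 / 8)) * u ^ (c - 1) := by
  have hgauss : Integrable fun t : ℝ ↦ K * Real.exp (-t ^ 2 / 8) * u ^ (c - 1) := by
    have h := (integrable_exp_neg_mul_sq (by norm_num : (0 : ℝ) < 1 / 8)).const_mul K
    refine (h.mul_const (u ^ (c - 1))).congr (ae_of_all _ fun t ↦ ?_)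
    simp only; ring_nf
  have h1 := norm_integral_le_of_norm_le hgauss (ae_of_all _ fun t ↦ (show
      ‖Φ ((c : ℂ) + t * I) * (u : ℂ) ^ ((c : ℂ) + t * I - 1)‖ ≤ K * Real.exp (-t ^ 2 / 8) * u ^ (c - 1) by
    rw [norm_mul, norm_cpow_line hu]
    exact mul_le_mul_of_nonneg_right (hK c hc t) (Real.rpow_nonneg hu.le _)))
  refine h1.trans (le_of_eq ?_)
  rw [integral_mul_const, integral_const_mul]

/-- `0 < ∫ e^{−t²/8} dt` (`= √(8π)`). [folklore] -/
private theorem integral_gauss_eighth : ∫ t : ℝ, Real.exp (-t ^ 2 / 8) = Real.sqrt (π / (1 / 8)) := by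
  have := integral_gaussian (1 / 8)
  rw [← this]
  congr 1; ext t; ring_nf

/-- **Measurability of the kernel** (Levinson: «there exists a function `R(u)` continuous for `u > 0`»;
downstream only measurability is used, which holds everywhere, `R_c` being a parametric integral of
a jointly measurable integrand). [cite: Levinson1956, §3 Lemma (regularity of R)] -/
theorem stronglyMeasurable_kernel (hΦd : DifferentiableOn ℂ Φ (re ⁻¹' Icc a b)) {c : ℝ}
    (hc : c ∈ Icc a b) :
    StronglyMeasurable fun u : ℝ ↦ ∫ t : ℝ, Φ ((c : ℂ) + t * I) * (u : ℂ) ^ ((c : ℂ) + t * I - 1) :=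
  (measurable_phi_mul_cpow hΦd hc).stronglyMeasurable.integral_prod_right'

/-- **(3.5): `∫₀^∞ u^{−k} |R(u)| du < ∞` for `a < k < b`** ([Levinson1956]: «Given `k` in (3.5) it
follows from (4.3) with `c = k + δ₁` and `c = k − δ₁` …»; here `c = b` on `(0,1]` and `c = a` on
`(1,∞)`, the kernel being independent of `c`). Stated for the kernel on the line `c ∈ [a,b]`.
[cite: Levinson1956, §3 Lemma (3.5), §4] -/
theorem integrableOn_rpow_neg_mul_norm_kernel (hΦd : DifferentiableOn ℂ Φ (re ⁻¹' Icc a b))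
    (hK : ∀ σ ∈ Icc a b, ∀ t : ℝ, ‖Φ ((σ : ℂ) + t * I)‖ ≤ K * Real.exp (-t ^ 2 / 8)) (hK0 : 0 < K)
    {c : ℝ} (hc : c ∈ Icc a b) {k : ℝ} (hak : a < k) (hkb : k < b) :
    IntegrableOn (fun u : ℝ ↦ u ^ (-k) *
      ‖∫ t : ℝ, Φ ((c : ℂ) + t * I) * (u : ℂ) ^ ((c : ℂ) + t * I - 1)‖) (Ioi 0) := by
  have hab : a ≤ b := (hak.trans hkb).le
  have ha : a ∈ Icc a b := ⟨le_rfl, hab⟩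
  have hb : b ∈ Icc a b := ⟨hab, le_rfl⟩
  set B : ℝ := K * ∫ t : ℝ, Real.exp (-t ^ 2 / 8) with hB
  have hB0 : 0 ≤ B := by
    rw [hB, integral_gauss_eighth]; positivity
  -- measurability
  have hmeas : AEStronglyMeasurable (fun u : ℝ ↦ u ^ (-k) *
      ‖∫ t : ℝ, Φ ((c : ℂ) + t * I) * (u : ℂ) ^ ((c : ℂ) + t * I - 1)‖) (volume.restrict (Ioi 0)) := by
    refine ((measurable_id.pow_const (-k)).mul ?_).aestronglyMeasurable
    exact (stronglyMeasurable_kernel hΦd hc).measurable.norm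
  -- split at `u = 1`
  rw [show Ioi (0 : ℝ) = Ioc 0 1 ∪ Ioi 1 by rw [Ioc_union_Ioi_eq_Ioi zero_le_one]]
  refine IntegrableOn.union ?_ ?_
  · -- on `(0,1]`: `u^{-k} |R_b(u)| ≤ B u^{b-1-k}`, exponent `> -1`
    have hint : IntegrableOn (fun u : ℝ ↦ B * u ^ (b - 1 - k)) (Ioc 0 1) := by
      have h := (intervalIntegral.integrableOn_Ioo_rpow_iff zero_lt_one).2 (by linarith : -1 < b - 1 - k)
      rw [← integrableOn_Ioc_iff_integrableOn_Ioo] at h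
      exact h.const_mul B
    refine hint.mono' (hmeas.mono_measure (Measure.restrict_mono Ioc_subset_Ioi_self le_rfl)) ?_
    refine (ae_restrict_mem measurableSet_Ioc).mono fun u hu ↦ ?_
    have hu0 : 0 < u := hu.1
    rw [Real.norm_eq_abs, abs_of_nonneg (by positivity), kernel_eq_of_mem_Icc hΦd hK hK0 hc hb hu0]
    calc u ^ (-k) * ‖∫ t : ℝ, Φ ((b : ℂ) + t * I) * (u : ℂ) ^ ((b : ℂ) + t * I - 1)‖
        ≤ u ^ (-k) * (B * u ^ (b - 1)) :=
          mul_le_mul_of_nonneg_left (norm_kernel_le hK hb hu0) (Real.rpow_nonneg hu0.le _)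
      _ = B * u ^ (b - 1 - k) := by
          rw [show b - 1 - k = -k + (b - 1) by ring, Real.rpow_add hu0]; ring
  · -- on `(1,∞)`: `u^{-k} |R_a(u)| ≤ B u^{a-1-k}`, exponent `< -1`
    have hint : IntegrableOn (fun u : ℝ ↦ B * u ^ (a - 1 - k)) (Ioi 1) :=
      ((integrableOn_Ioi_rpow_iff zero_lt_one).2 (by linarith : a - 1 - k < -1)).const_mul B
    refine hint.mono' (hmeas.mono_measure (Measure.restrict_mono (Ioi_subset_Ioi zero_le_one) le_rfl)) ?_
    refine (ae_restrict_mem measurableSet_Ioi).mono fun u hu ↦ ?_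
    have hu0 : 0 < u := zero_lt_one.trans hu
    rw [Real.norm_eq_abs, abs_of_nonneg (by positivity), kernel_eq_of_mem_Icc hΦd hK hK0 hc ha hu0]
    calc u ^ (-k) * ‖∫ t : ℝ, Φ ((a : ℂ) + t * I) * (u : ℂ) ^ ((a : ℂ) + t * I - 1)‖
        ≤ u ^ (-k) * (B * u ^ (a - 1)) :=
          mul_le_mul_of_nonneg_left (norm_kernel_le hK ha hu0) (Real.rpow_nonneg hu0.le _)
      _ = B * u ^ (a - 1 - k) := by
          rw [show a - 1 - k = -k + (a - 1) by ring, Real.rpow_add hu0]; ring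

/-- Points of the product `(0,∞) × ℝ` have positive first coordinate, almost everywhere. [folklore] -/
private theorem ae_fst_pos :
    ∀ᵐ q : ℝ × ℝ ∂((volume.restrict (Ioi (0 : ℝ))).prod volume), 0 < q.1 :=
  (Measure.quasiMeasurePreserving_fst (μ := volume.restrict (Ioi (0 : ℝ))) (ν := volume)).ae
    (ae_restrict_mem measurableSet_Ioi)

/-- **Fubini for `∫₀^∞ R_c(u) du/(e^{xu}+1)`** (first half of the proof of (3.6)): for `x > 0` and
`0 < a ≤ c ≤ b < 1`,
`∫₀^∞ R_c(u)/(e^{xu}+1) du = ∫ Φ(c+it) · x^{−s}Γ(s)(1−2^{1−s})ζ(s) dt` (`s = c + it`), by the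
Fermi–Dirac Mellin transform `∫₀^∞ u^{s−1} du/(e^{xu}+1) = x^{−s}Γ(s)(1−2^{1−s})ζ(s)` of the tree
(`integral_cpow_mul_fermiDirac_comp`, [Titchmarsh1986, (2.2.1)/§2.5]).
[cite: Levinson1956, §4 (proof of (3.6))] -/
theorem integral_fermiDirac_mul_kernel_eq (hΦd : DifferentiableOn ℂ Φ (re ⁻¹' Icc a b))
    (hK : ∀ σ ∈ Icc a b, ∀ t : ℝ, ‖Φ ((σ : ℂ) + t * I)‖ ≤ K * Real.exp (-t ^ 2 / 8))
    (ha0 : 0 < a) (hb1 : b < 1) {c : ℝ} (hc : c ∈ Icc a b) {x : ℝ} (hx : 0 < x) :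
    ∫ u in Ioi (0 : ℝ), (((Real.exp (x * u) + 1 : ℝ) : ℂ)⁻¹) *
        ∫ t : ℝ, Φ ((c : ℂ) + t * I) * (u : ℂ) ^ ((c : ℂ) + t * I - 1) =
      ∫ t : ℝ, Φ ((c : ℂ) + t * I) * ((x : ℂ) ^ (-((c : ℂ) + t * I)) *
        (Complex.Gamma ((c : ℂ) + t * I) * ((1 - 2 ^ (1 - ((c : ℂ) + t * I))) *
          riemannZeta ((c : ℂ) + t * I)))) := by
  have hc0 : 0 < c := ha0.trans_le hc.1
  have hc1 : c < 1 := lt_of_le_of_lt hc.2 hb1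
  -- the joint integrand
  set F : ℝ → ℝ → ℂ := fun u t ↦ (((Real.exp (x * u) + 1 : ℝ) : ℂ)⁻¹) *
    (Φ ((c : ℂ) + t * I) * (u : ℂ) ^ ((c : ℂ) + t * I - 1)) with hF
  -- integrability on the product
  have hkd : ∀ u : ℝ, 0 ≤ (Real.exp (x * u) + 1)⁻¹ := fun u ↦ by positivity
  have hknorm : ∀ u : ℝ, ‖(((Real.exp (x * u) + 1 : ℝ) : ℂ)⁻¹)‖ = (Real.exp (x * u) + 1)⁻¹ := by
    intro u
    rw [norm_inv, Complex.norm_real, Real.norm_eq_abs, abs_of_pos (by positivity)]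
  have hmeasF : AEStronglyMeasurable (Function.uncurry F) ((volume.restrict (Ioi 0)).prod volume) := by
    refine (Measurable.mul ?_ (measurable_phi_mul_cpow hΦd hc)).aestronglyMeasurable
    refine (Complex.measurable_ofReal.comp ?_).inv
    exact ((measurable_fst.const_mul x).exp.add_const 1)
  have hg₁ : Integrable (fun u : ℝ ↦ ‖(u : ℂ) ^ ((c : ℂ) - 1) * (((Real.exp (x * u) + 1 : ℝ) : ℂ)⁻¹)‖)
      (volume.restrict (Ioi 0)) :=
    (integrableOn_cpow_mul_fermiDirac_comp hx (s := (c : ℂ)) (by simpa using hc0)).norm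
  have hg₂ : Integrable (fun t : ℝ ↦ K * Real.exp (-t ^ 2 / 8)) := by
    have h := (integrable_exp_neg_mul_sq (by norm_num : (0 : ℝ) < 1 / 8)).const_mul K
    refine h.congr (ae_of_all _ fun t ↦ ?_)
    simp only; ring_nf
  have hint : Integrable (Function.uncurry F) ((volume.restrict (Ioi 0)).prod volume) := by
    refine (hg₁.mul_prod hg₂).mono' hmeasF ?_
    filter_upwards [ae_fst_pos] with q hq
    simp only [Function.uncurry, hF, norm_mul, hknorm]
    rw [norm_cpow_line hq, Complex.norm_cpow_eq_rpow_re_of_pos hq]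
    simp only [sub_re, ofReal_re, one_re]
    have h1 := hK c hc q.2
    have h2 : 0 ≤ q.1 ^ (c - 1) := Real.rpow_nonneg hq.le _
    calc (Real.exp (x * q.1) + 1)⁻¹ * (‖Φ ((c : ℂ) + q.2 * I)‖ * q.1 ^ (c - 1))
        = q.1 ^ (c - 1) * (Real.exp (x * q.1) + 1)⁻¹ * ‖Φ ((c : ℂ) + q.2 * I)‖ := by ring
      _ ≤ q.1 ^ (c - 1) * (Real.exp (x * q.1) + 1)⁻¹ * (K * Real.exp (-q.2 ^ 2 / 8)) :=
          mul_le_mul_of_nonneg_left h1 (mul_nonneg h2 (hkd _))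
  -- swap
  have hswap := integral_integral_swap hint
  simp only [hF] at hswap
  have lhs : ∫ u in Ioi (0 : ℝ), (((Real.exp (x * u) + 1 : ℝ) : ℂ)⁻¹) *
        ∫ t : ℝ, Φ ((c : ℂ) + t * I) * (u : ℂ) ^ ((c : ℂ) + t * I - 1) =
      ∫ u in Ioi (0 : ℝ), ∫ t : ℝ, (((Real.exp (x * u) + 1 : ℝ) : ℂ)⁻¹) *
        (Φ ((c : ℂ) + t * I) * (u : ℂ) ^ ((c : ℂ) + t * I - 1)) := by
    refine setIntegral_congr_fun measurableSet_Ioi fun u _ ↦ ?_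
    exact (integral_const_mul _ _).symm
  rw [lhs, hswap]
  refine integral_congr_ae (ae_of_all _ fun t ↦ ?_)
  set s : ℂ := (c : ℂ) + t * I with hs
  have hsre : 0 < s.re := by simp [hs, hc0]
  have hs1 : s ≠ 1 := by
    intro h; have := congrArg Complex.re h; simp [hs] at this; linarith
  have hM := integral_cpow_mul_fermiDirac_comp hx hsre hs1
  simp only
  calc ∫ u in Ioi (0 : ℝ), (((Real.exp (x * u) + 1 : ℝ) : ℂ)⁻¹) * (Φ s * (u : ℂ) ^ (s - 1))
      = Φ s * ∫ u in Ioi (0 : ℝ), (u : ℂ) ^ (s - 1) * (((Real.exp (x * u) + 1 : ℝ) : ℂ)⁻¹) := by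
        rw [← integral_const_mul]
        refine setIntegral_congr_fun measurableSet_Ioi fun u _ ↦ ?_
        ring
    _ = Φ s * ((x : ℂ) ^ (-s) * (Complex.Gamma s * ((1 - 2 ^ (1 - s)) * riemannZeta s))) := by rw [hM]

end Kernel

/-! ## (3.6) for Levinson's `Φ_p` -/

/-- **Levinson's Lemma, (3.6)**: with `R_c(u) = ∫ Φ_p(c+it) u^{c+it−1} dt`,
`Φ_p(s) = exp((s+ip)²/2)/(Γ(s)(1−2^{1−s})ζ(s))`, and `ζ ≠ 0` on `a − δ < Re s < b + δ`
(`1/2 ≤ a ≤ c ≤ b < 1`), for every `x > 0`: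
`∫₀^∞ R_c(u) du/(e^{xu} + 1) = (2π)^{1/2} exp(i p log x − ½ log² x)`
(Levinson's (3.6) `∫₀^∞ e^{−ux}/(1+e^{−ux}) R(u) du = exp(−½ log² x + ip log x)` for his
`R = (2π)^{−1/2} R_c`). [cite: Levinson1956, §3 Lemma (3.6), §4] -/
theorem integral_fermiDirac_mul_kernel (hδ : 0 < δ) (ha : 1 / 2 ≤ a) (hab : a ≤ b) (hb : b < 1)
    (hZ : ∀ s : ℂ, a - δ < s.re → s.re < b + δ → riemannZeta s ≠ 0) (p : ℝ) {Φ : ℂ → ℂ}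
    (hΦ : ∀ s, Φ s = cexp ((s + p * I) ^ 2 / 2) / (Complex.Gamma s * ((1 - 2 ^ (1 - s)) * riemannZeta s)))
    {c : ℝ} (hc : c ∈ Icc a b) {x : ℝ} (hx : 0 < x) :
    ∫ u in Ioi (0 : ℝ), (((Real.exp (x * u) + 1 : ℝ) : ℂ)⁻¹) *
        ∫ t : ℝ, Φ ((c : ℂ) + t * I) * (u : ℂ) ^ ((c : ℂ) + t * I - 1) =
      ((2 * π : ℂ)) ^ (1 / 2 : ℂ) * cexp (I * p * Real.log x - (Real.log x : ℂ) ^ 2 / 2) := by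
  obtain ⟨K, hK0, hK⟩ := exists_norm_phi_le hδ ha hab hb hZ p
  have hΦfun : Φ = fun s ↦ cexp ((s + p * I) ^ 2 / 2) /
      (Complex.Gamma s * ((1 - 2 ^ (1 - s)) * riemannZeta s)) := funext hΦ
  have hK' : ∀ σ ∈ Icc a b, ∀ t : ℝ, ‖Φ ((σ : ℂ) + t * I)‖ ≤ K * Real.exp (-t ^ 2 / 8) := by
    intro σ hσ t; rw [hΦ]; exact hK σ hσ t
  have hΦd : DifferentiableOn ℂ Φ (re ⁻¹' Icc a b) := by
    rw [hΦfun]; exact differentiableOn_phi hδ ha hb hZ p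
  rw [integral_fermiDirac_mul_kernel_eq hΦd hK' (by linarith) hb hc hx]
  -- cancel the denominators
  have hc0 : 0 < c := by linarith [hc.1]
  have hc1 : c < 1 := lt_of_le_of_lt hc.2 hb
  set L : ℝ := Real.log x with hL
  have hxlog : Complex.log (x : ℂ) = (L : ℂ) := (Complex.ofReal_log hx.le).symm
  have hx0 : (x : ℂ) ≠ 0 := by exact_mod_cast hx.ne'
  have step : ∀ t : ℝ, Φ ((c : ℂ) + t * I) * ((x : ℂ) ^ (-((c : ℂ) + t * I)) *
      (Complex.Gamma ((c : ℂ) + t * I) * ((1 - 2 ^ (1 - ((c : ℂ) + t * I))) *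
        riemannZeta ((c : ℂ) + t * I)))) =
      cexp (-1 / 2 * (t : ℂ) ^ 2 + (-p + (c - L) * I) * t + (c ^ 2 / 2 - p ^ 2 / 2 - c * L + c * p * I)) := by
    intro t
    set s : ℂ := (c : ℂ) + t * I with hs
    have hsre : s.re = c := by simp [hs]
    have hre0 : 0 < s.re := by rw [hsre]; exact hc0
    have hΓ0 : Complex.Gamma s ≠ 0 := Complex.Gamma_ne_zero_of_re_pos hre0
    have hζ0 : riemannZeta s ≠ 0 := hZ s (by rw [hsre]; linarith [hc.1]) (by rw [hsre]; linarith [hc.2])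
    have h20 : (1 : ℂ) - 2 ^ (1 - s) ≠ 0 := by
      intro h
      have := norm_one_sub_two_cpow_ge s
      rw [h, norm_zero, hsre] at this
      have hlog2 : 0 < Real.log 2 := Real.log_pos (by norm_num)
      nlinarith
    have hD : Complex.Gamma s * ((1 - 2 ^ (1 - s)) * riemannZeta s) ≠ 0 :=
      mul_ne_zero hΓ0 (mul_ne_zero h20 hζ0)
    rw [hΦ]
    have e1 : cexp ((s + p * I) ^ 2 / 2) / (Complex.Gamma s * ((1 - 2 ^ (1 - s)) * riemannZeta s)) *
        ((x : ℂ) ^ (-s) * (Complex.Gamma s * ((1 - 2 ^ (1 - s)) * riemannZeta s))) =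
        cexp ((s + p * I) ^ 2 / 2) * (x : ℂ) ^ (-s) := by
      field_simp
    rw [e1, Complex.cpow_def_of_ne_zero hx0, hxlog, ← Complex.exp_add]
    congr 1
    rw [hs]
    ring_nf
    rw [Complex.I_sq]
    ring
  simp_rw [step]
  rw [integral_cexp_quadratic (by norm_num : (-1 / 2 : ℂ).re < 0)]
  have e2 : (π : ℂ) / -(-1 / 2 : ℂ) = 2 * π := by ring
  have e3 : ((c : ℂ) ^ 2 / 2 - (p : ℂ) ^ 2 / 2 - (c : ℂ) * L + (c : ℂ) * p * I) -
      (-(p : ℂ) + ((c : ℂ) - L) * I) ^ 2 / (4 * (-1 / 2 : ℂ)) = I * p * L - (L : ℂ) ^ 2 / 2 := by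
    linear_combination (((c : ℂ) - L) ^ 2 / 2) * Complex.I_sq
  rw [e2, e3]

end LevinsonKernel

end Literature.NumberTheory.LFunctions

end
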